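import Summits.QuantumFields.YangMills.Theorems.FemtoCutoffLadderFixedLatticeLawReduction
import Summits.QuantumFields.YangMills.Theorems.FemtoTransferGapGroundState
import Summits.QuantumFields.YangMills.Theorems.FemtoTransferGapPositivity
import Summits.QuantumFields.YangMills.Theses.FemtoCutoffLadder

/-!
# Crux `FixedLatticeLaw` (stmt-QuantumFields-23943 = tree leaf `FemtoGapFixedLattice`) ⟸ the FLAT-TUBE SPLIT:
# (K1) Born–Oppenheimer in the near-flat tube + (K2) off-tube suppression

Seat `ym-line-fcl-p3` g2 (2026-08-28; explicit-unit prover of route `FemtoCutoffLadder`).  Rung R2b1 = the RECORD-label femto transfer gap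
`FemtoGapOfRecord`: NOT infinite volume, NOT the Clay mass gap, no summit.

The route planner ym-idea-1 g3 filed the layer-2 split of this node as route `FlatTubeReduction` (draft): K1 = `NearFlatRatioLaw`
(stmt-QuantumFields-24720: for a tube-supported physical `ψ ⊥ Ω`, `⟨ψ,K_βψ⟩·μ₀(L³β) ≤ e^{Cλ_b²/L}·μ₁(L³β)·λ₀(β,L)·‖ψ‖²`) and K2 =
`OffTubeSuppression` (stmt-QuantumFields-24721: every physical `ψ ⊥ Ω` has a tube-supported physical `ψ' ⊥ Ω` with `‖ψ'‖ ≤ ‖ψ‖` and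
`⟨ψ,Kψ⟩ ≤ ⟨ψ',Kψ'⟩ + (λ_b³/L)λ₀‖ψ‖²`), and supplied a certified glue proof (critic idea-crit-4 price P1, 02:18Z: «land a glue theorem
K1 → K2 → FixedLatticeLaw --supports 23943 so FCL's node closes the moment K1, K2 close»).  This file lands that glue with K1 and K2 SPELLED OUT
VERBATIM as hypotheses (the bodies of the two `Theses.FlatTubeReduction` decls), so it does not depend on the newborn route module:

* ★ `femtoGapFixedLattice_of_nearFlat_offTube : K1 → K2 → FemtoGapFixedLattice`;
* ★ `fixedLatticeLaw_of_nearFlat_offTube : K1 → K2 → Theses.FemtoCutoffLadder.FixedLatticeLaw` (the item's decl BY NAME; `rfl`-equal bodies).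

Proof (planner's body, verbatim up to names): min–max for `secondValue` with the exact positive physical ground state `Ω`
(`PhysL2.exists_groundState`) as test vector; for physical `ψ ⊥ Ω`, K2 then K1 on the tube state; the collar `(λ_b³/L)λ₀` is absorbed into the
`O(λ_b²/L)` exponent by `λ_b ≤ 1` (`β ≥ 2`) and `μ₀(L³β) ≤ e^{|levelGap 1|+|C₂|}·μ₁(L³β)` from the proved one-site LOWER law (`oneSiteLevels_proof`,
`bareLambda_cube_mul`); then `femtoGapFixedLattice_of_fixedLReduction` divides by `μ₀ > 0`.

HONEST FRAMING: K1 (XL: degenerate toron-valley Born–Oppenheimer at precision `λ_b²/L`, in print only for `L = 1`) and K2 (M) are OPEN; nothing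
here proves them, and `FixedLatticeLaw` stays open.  No definitions, no named facts, no `sorry`.
-/

set_option autoImplicit false

noncomputable section

namespace Summit.QuantumFields.YangMills.Theorems.FemtoCutoffLadder

open Real
open Summit.QuantumFields.YangMills.Theorems.FemtoTransferGap
open Literature.Analysis.OperatorTheory.YMMatrixModel

/-- One-site bookkeeping at level `k = 1`: eventually in the coupling `B`, `μ₀(B) > 0`, `μ₁(B) ≥ 0` and `μ₀(B) ≤ M·μ₁(B)` with ONE constant
`M = exp(|levelGap 1| + |C|)` — from the proved one-site LOWER law `exp(−(levelGap 1·λ_b + Cλ_b²))·μ₀ ≤ μ₁` (`oneSiteLevels_proof 1`) and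
`λ_b(B) ≤ 1` for `B ≥ 2`. [cite: Luscher1983, §2] -/
theorem oneSite_ground_le_first :
    ∃ M B0 : ℝ, 0 ≤ M ∧ ∀ B : ℝ, B0 ≤ B →
      0 < levelValue su2Rep 1 B 0 ∧ 0 ≤ levelValue su2Rep 1 B 1 ∧
        levelValue su2Rep 1 B 0 ≤ M * levelValue su2Rep 1 B 1 := by
  obtain ⟨C₂, B0, hONE⟩ := oneSiteLevels_proof 1
  refine ⟨Real.exp (|levelGap 1| + |C₂|), max B0 2, (Real.exp_pos _).le, fun B hB => ?_⟩
  have hB0 : B0 ≤ B := (le_max_left _ _).trans hB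
  have h2B : (2 : ℝ) ≤ B := (le_max_right _ _).trans hB
  have hBpos : 0 < B := by linarith
  obtain ⟨hμ0pos, -, hlow⟩ := hONE B hB0
  have hμ1nn : 0 ≤ levelValue su2Rep 1 B 1 := levelValue_su2Rep_nonneg 1 hBpos.le 1
  refine ⟨hμ0pos, hμ1nn, ?_⟩
  set w := bareLambda B with hwdef
  have hw0 : 0 ≤ w := by
    rw [hwdef, bareLambda]; exact (Real.rpow_pos_of_pos (by positivity) _).le
  have hw1 : w ≤ 1 := by
    rw [hwdef, bareLambda]
    apply Real.rpow_le_one (by positivity) _ (by norm_num)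
    rw [div_le_one hBpos]; exact h2B
  have hexp_le : levelGap 1 * w + C₂ * w ^ 2 ≤ |levelGap 1| + |C₂| := by
    have e1 : levelGap 1 * w ≤ |levelGap 1| := by
      calc levelGap 1 * w ≤ |levelGap 1| * w := mul_le_mul_of_nonneg_right (le_abs_self _) hw0
        _ ≤ |levelGap 1| * 1 := mul_le_mul_of_nonneg_left hw1 (abs_nonneg _)
        _ = |levelGap 1| := mul_one _
    have e2 : C₂ * w ^ 2 ≤ |C₂| := by
      have hsq : w ^ 2 ≤ 1 := by
        calc w ^ 2 ≤ 1 ^ 2 := pow_le_pow_left₀ hw0 hw1 2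
          _ = 1 := one_pow 2
      calc C₂ * w ^ 2 ≤ |C₂| * w ^ 2 := mul_le_mul_of_nonneg_right (le_abs_self _) (sq_nonneg _)
        _ ≤ |C₂| * 1 := mul_le_mul_of_nonneg_left hsq (abs_nonneg _)
        _ = |C₂| := mul_one _
    linarith
  have h' : levelValue su2Rep 1 B 0 ≤ Real.exp (levelGap 1 * w + C₂ * w ^ 2) * levelValue su2Rep 1 B 1 := by
    have := mul_le_mul_of_nonneg_left hlow (Real.exp_pos (levelGap 1 * w + C₂ * w ^ 2)).le
    rwa [← mul_assoc, ← Real.exp_add, add_neg_cancel, Real.exp_zero, one_mul] at this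
  exact h'.trans (mul_le_mul_of_nonneg_right (Real.exp_le_exp.mpr hexp_le) hμ1nn)

/-- Absorption of the collar: for `v ≤ 1`, `L > 0`, `M ≥ 0` and `μ₀ ≤ M·μ₁` (all quantities nonnegative),
`e^{Cv²/L}·μ₁·top + (v³/L)·top·μ₀ ≤ e^{(|C|+M)v²/L}·(μ₁·top)` — `v³ ≤ v²`, `e^{a} + b ≤ e^{a}·e^{b}` for `a, b ≥ 0`. -/
theorem collar_absorb {C M v L μ0 μ1 top : ℝ} (hL : 0 < L) (hv1 : v ≤ 1) (hM : 0 ≤ M)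
    (hμ0 : 0 ≤ μ0) (hμ1 : 0 ≤ μ1) (htop : 0 ≤ top) (hμ0M : μ0 ≤ M * μ1) :
    Real.exp (C * v ^ 2 / L) * μ1 * top + v ^ 3 / L * top * μ0 ≤ Real.exp ((|C| + M) * v ^ 2 / L) * (μ1 * top) := by
  have hv32 : v ^ 3 ≤ v ^ 2 := by
    calc v ^ 3 = v ^ 2 * v := by ring
      _ ≤ v ^ 2 * 1 := mul_le_mul_of_nonneg_left hv1 (sq_nonneg v)
      _ = v ^ 2 := mul_one _
  have hCabs : Real.exp (C * v ^ 2 / L) ≤ Real.exp (|C| * v ^ 2 / L) := by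
    rw [Real.exp_le_exp]
    exact div_le_div_of_nonneg_right (mul_le_mul_of_nonneg_right (le_abs_self C) (sq_nonneg v)) hL.le
  have hterm2 : v ^ 3 / L * top * μ0 ≤ (M * v ^ 2 / L) * (μ1 * top) := by
    calc v ^ 3 / L * top * μ0 ≤ v ^ 2 / L * top * (M * μ1) := by
            apply mul_le_mul (mul_le_mul_of_nonneg_right (div_le_div_of_nonneg_right hv32 hL.le) htop) hμ0M hμ0
            positivity
      _ = (M * v ^ 2 / L) * (μ1 * top) := by ring
  have ha : 0 ≤ |C| * v ^ 2 / L := by positivity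
  have hb : 0 ≤ M * v ^ 2 / L := by positivity
  have hone : 1 ≤ Real.exp (|C| * v ^ 2 / L) := Real.one_le_exp ha
  have hμt : 0 ≤ μ1 * top := mul_nonneg hμ1 htop
  calc Real.exp (C * v ^ 2 / L) * μ1 * top + v ^ 3 / L * top * μ0
      ≤ Real.exp (|C| * v ^ 2 / L) * (μ1 * top) + (M * v ^ 2 / L) * (μ1 * top) := by
          have := mul_le_mul_of_nonneg_right hCabs hμt
          nlinarith [hterm2, this]
    _ = (Real.exp (|C| * v ^ 2 / L) + M * v ^ 2 / L) * (μ1 * top) := by ring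
    _ ≤ (Real.exp (|C| * v ^ 2 / L) * Real.exp (M * v ^ 2 / L)) * (μ1 * top) := by
          apply mul_le_mul_of_nonneg_right _ hμt
          have h1' : M * v ^ 2 / L ≤ Real.exp (|C| * v ^ 2 / L) * (M * v ^ 2 / L) :=
            le_mul_of_one_le_left hb hone
          have h2' : 1 + M * v ^ 2 / L ≤ Real.exp (M * v ^ 2 / L) := by
            have := Real.add_one_le_exp (M * v ^ 2 / L); linarith
          nlinarith [h1', h2', Real.exp_pos (|C| * v ^ 2 / L)]
    _ = Real.exp ((|C| + M) * v ^ 2 / L) * (μ1 * top) := by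
          rw [← Real.exp_add]; ring_nf

/-- ★ **K1 → K2 → the fixed-lattice leaf.**  If (K1, `FlatTubeReduction.NearFlatRatioLaw` spelled out) on every fixed lattice some polynomial
tube `{S ≤ β^{-θ}}`, `θ ∈ (0,1)`, carries the Born–Oppenheimer bound `⟨ψ,K_βψ⟩·μ₀(L³β) ≤ e^{Cλ_b²/L}·μ₁(L³β)·λ₀·‖ψ‖²` for tube-supported
physical `ψ ⊥ Ω`, and (K2, `FlatTubeReduction.OffTubeSuppression` spelled out) every physical `ψ ⊥ Ω` can be truncated to such a tube at cost
`(λ_b³/L)λ₀‖ψ‖²`, then `λ₁(β,L) ≤ exp(−(ε₁λ_b − C_Lλ_b²)/L)·λ₀(β,L)` eventually in `β`, for every `L`. [cite: Luscher1983, §3]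
[cite: LuscherMunster1984, §2] -/
theorem femtoGapFixedLattice_of_nearFlat_offTube
    (h₁ : ∀ (L : ℕ) [NeZero L], ∃ θ C β0 : ℝ, 0 < θ ∧ θ < 1 ∧ ∀ β : ℝ, β0 ≤ β → ∀ (Ω ψ :
      Literature.MathematicalPhysics.QuantumFieldTheory.GaugeConfig 3 L SU2 → ℝ), IsPhys Ω → (∀ U, 0 < Ω U) →
      transferApply β Ω = topValue su2Rep L β • Ω → IsPhys ψ → l2 ψ Ω = 0 → (∀ U, β ^ (-θ) <
      Literature.MathematicalPhysics.QuantumFieldTheory.wilsonAction su2Rep U → ψ U = 0) → qform su2Rep β ψ ψ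
      * levelValue su2Rep 1 ((L : ℝ) ^ 3 * β) 0 ≤ Real.exp (C * bareLambda β ^ 2 / L) * levelValue su2Rep 1
      ((L : ℝ) ^ 3 * β) 1 * topValue su2Rep L β * l2 ψ ψ)
    (h₂ : ∀ (L : ℕ) [NeZero L] (θ : ℝ), 0 < θ → θ < 1 → ∃ β0 : ℝ, ∀ β : ℝ, β0 ≤ β → ∀ (Ω ψ :
      Literature.MathematicalPhysics.QuantumFieldTheory.GaugeConfig 3 L SU2 → ℝ), IsPhys Ω → (∀ U, 0 < Ω U) →
      transferApply β Ω = topValue su2Rep L β • Ω → IsPhys ψ → l2 ψ Ω = 0 → ∃ ψ' :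
      Literature.MathematicalPhysics.QuantumFieldTheory.GaugeConfig 3 L SU2 → ℝ, IsPhys ψ' ∧ l2 ψ' Ω = 0 ∧ (∀
      U, β ^ (-θ) < Literature.MathematicalPhysics.QuantumFieldTheory.wilsonAction su2Rep U → ψ' U = 0) ∧ l2
      ψ' ψ' ≤ l2 ψ ψ ∧ qform su2Rep β ψ ψ ≤ qform su2Rep β ψ' ψ' + bareLambda β ^ 3 / L * topValue su2Rep L β
      * l2 ψ ψ) :
    FemtoGapFixedLattice := by
  refine femtoGapFixedLattice_of_fixedLReduction ?_
  intro L _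
  obtain ⟨θ, C, β₁, hθ0, hθ1, H1⟩ := h₁ L
  obtain ⟨β₂, H2⟩ := h₂ L θ hθ0 hθ1
  obtain ⟨M, B0, hMnn, hONE⟩ := oneSite_ground_le_first
  refine ⟨|C| + M, max (max β₁ β₂) (max 2 B0), fun β hβ => ?_⟩
  have hβ₁ : β₁ ≤ β := le_trans (le_trans (le_max_left _ _) (le_max_left _ _)) hβ
  have hβ₂ : β₂ ≤ β := le_trans (le_trans (le_max_right _ _) (le_max_left _ _)) hβ
  have h2β : (2 : ℝ) ≤ β := le_trans (le_trans (le_max_left _ _) (le_max_right _ _)) hβ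
  have hB0 : B0 ≤ β := le_trans (le_trans (le_max_right _ _) (le_max_right _ _)) hβ
  have hβpos : 0 < β := by linarith
  have hL1 : (1 : ℝ) ≤ (L : ℝ) := by exact_mod_cast NeZero.one_le
  have hLpos : (0 : ℝ) < (L : ℝ) := by linarith
  have hL3 : (1 : ℝ) ≤ (L : ℝ) ^ 3 := one_le_pow₀ hL1
  have hBge : β ≤ (L : ℝ) ^ 3 * β := le_mul_of_one_le_left hβpos.le hL3
  obtain ⟨hμ0pos, hμ1nn, hμ0M⟩ := hONE ((L : ℝ) ^ 3 * β) (hB0.trans hBge)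
  set μ0 := levelValue su2Rep 1 ((L : ℝ) ^ 3 * β) 0 with hμ0def
  set μ1 := levelValue su2Rep 1 ((L : ℝ) ^ 3 * β) 1 with hμ1def
  set v := bareLambda β with hvdef
  -- 0 < v ≤ 1
  have hv0 : 0 < v := by
    rw [hvdef, bareLambda]; exact Real.rpow_pos_of_pos (by positivity) _
  have hv1 : v ≤ 1 := by
    rw [hvdef, bareLambda]
    apply Real.rpow_le_one (by positivity) _ (by norm_num)
    rw [div_le_one hβpos]; exact h2β
  -- the exact positive physical ground state
  obtain ⟨Ω, θg, c, hΩ, hc, hcle, hn, heig, -, -, -⟩ := PhysL2.exists_groundState (L := L) β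
  have hΩpos : ∀ U, 0 < Ω U := fun U => hc.trans_le (hcle U)
  set top := topValue su2Rep L β with htopdef
  have htop : 0 < top := topValue_su2Rep_pos L β
  set X : ℝ := Real.exp (C * v ^ 2 / L) * μ1 * top + v ^ 3 / L * top * μ0 with hXdef
  have hE : 0 ≤ Real.exp (C * v ^ 2 / L) * μ1 * top := by positivity
  have hXnn : 0 ≤ X := by positivity
  -- the key bound for physical ψ ⊥ Ω: K2 (truncate to the tube), then K1 (Born–Oppenheimer in the tube)
  have key : ∀ ψ : Literature.MathematicalPhysics.QuantumFieldTheory.GaugeConfig 3 L SU2 → ℝ,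
      IsPhys ψ → l2 ψ Ω = 0 → qform su2Rep β ψ ψ * μ0 ≤ X * l2 ψ ψ := by
    intro ψ hψ horth
    obtain ⟨ψ', hψ', horth', hsupp', hle', hq⟩ := H2 β hβ₂ Ω ψ hΩ hΩpos heig hψ horth
    have h1 := H1 β hβ₁ Ω ψ' hΩ hΩpos heig hψ' horth' hsupp'
    calc qform su2Rep β ψ ψ * μ0
        ≤ (qform su2Rep β ψ' ψ' + v ^ 3 / L * top * l2 ψ ψ) * μ0 := mul_le_mul_of_nonneg_right hq hμ0pos.le
      _ = qform su2Rep β ψ' ψ' * μ0 + v ^ 3 / L * top * μ0 * l2 ψ ψ := by ring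
      _ ≤ Real.exp (C * v ^ 2 / L) * μ1 * top * l2 ψ' ψ' + v ^ 3 / L * top * μ0 * l2 ψ ψ := by linarith [h1]
      _ ≤ Real.exp (C * v ^ 2 / L) * μ1 * top * l2 ψ ψ + v ^ 3 / L * top * μ0 * l2 ψ ψ := by
          linarith [mul_le_mul_of_nonneg_left hle' hE]
      _ = X * l2 ψ ψ := by rw [hXdef]; ring
  -- min–max: secondValue ≤ sSup (Rayleigh quotients of physical ψ ⊥ Ω) ≤ X / μ0
  have hS : sSup (rayleighSet su2Rep L β fun ψ => l2 ψ Ω = 0) ≤ X / μ0 := by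
    apply Real.sSup_le _ (div_nonneg hXnn hμ0pos.le)
    rintro r ⟨ψ, hψ, horth, hpos, rfl⟩
    rw [div_le_div_iff₀ hpos hμ0pos]
    exact key ψ hψ horth
  have hsec : secondValue su2Rep L β ≤ X / μ0 := by
    refine le_trans (csInf_le ?_ ⟨Ω, hΩ, rfl⟩) hS
    refine ⟨0, ?_⟩
    rintro s ⟨φ, -, rfl⟩
    apply Real.sSup_nonneg
    intro r hr
    exact rayleigh_nonneg_fundamentalRep hβpos.le hr
  have hfin : secondValue su2Rep L β * μ0 ≤ X := by
    have := mul_le_mul_of_nonneg_right hsec hμ0pos.le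
    rwa [div_mul_cancel₀ _ hμ0pos.ne'] at this
  -- absorption of the collar into the `O(λ_b²/L)` exponent
  exact hfin.trans (collar_absorb hLpos hv1 hMnn hμ0pos.le hμ1nn htop.le hμ0M)

/-- ★ **The item's decl BY NAME**: K1 → K2 → `Theses.FemtoCutoffLadder.FixedLatticeLaw` (stmt-QuantumFields-23943; body `rfl`-equal to the
leaf `FemtoGapFixedLattice`). -/
theorem fixedLatticeLaw_of_nearFlat_offTube
    (h₁ : ∀ (L : ℕ) [NeZero L], ∃ θ C β0 : ℝ, 0 < θ ∧ θ < 1 ∧ ∀ β : ℝ, β0 ≤ β → ∀ (Ω ψ :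
      Literature.MathematicalPhysics.QuantumFieldTheory.GaugeConfig 3 L SU2 → ℝ), IsPhys Ω → (∀ U, 0 < Ω U) →
      transferApply β Ω = topValue su2Rep L β • Ω → IsPhys ψ → l2 ψ Ω = 0 → (∀ U, β ^ (-θ) <
      Literature.MathematicalPhysics.QuantumFieldTheory.wilsonAction su2Rep U → ψ U = 0) → qform su2Rep β ψ ψ
      * levelValue su2Rep 1 ((L : ℝ) ^ 3 * β) 0 ≤ Real.exp (C * bareLambda β ^ 2 / L) * levelValue su2Rep 1
      ((L : ℝ) ^ 3 * β) 1 * topValue su2Rep L β * l2 ψ ψ)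
    (h₂ : ∀ (L : ℕ) [NeZero L] (θ : ℝ), 0 < θ → θ < 1 → ∃ β0 : ℝ, ∀ β : ℝ, β0 ≤ β → ∀ (Ω ψ :
      Literature.MathematicalPhysics.QuantumFieldTheory.GaugeConfig 3 L SU2 → ℝ), IsPhys Ω → (∀ U, 0 < Ω U) →
      transferApply β Ω = topValue su2Rep L β • Ω → IsPhys ψ → l2 ψ Ω = 0 → ∃ ψ' :
      Literature.MathematicalPhysics.QuantumFieldTheory.GaugeConfig 3 L SU2 → ℝ, IsPhys ψ' ∧ l2 ψ' Ω = 0 ∧ (∀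
      U, β ^ (-θ) < Literature.MathematicalPhysics.QuantumFieldTheory.wilsonAction su2Rep U → ψ' U = 0) ∧ l2
      ψ' ψ' ≤ l2 ψ ψ ∧ qform su2Rep β ψ ψ ≤ qform su2Rep β ψ' ψ' + bareLambda β ^ 3 / L * topValue su2Rep L β
      * l2 ψ ψ) :
    Summit.QuantumFields.YangMills.Theses.FemtoCutoffLadder.FixedLatticeLaw :=
  femtoGapFixedLattice_of_nearFlat_offTube h₁ h₂

end Summit.QuantumFields.YangMills.Theorems.FemtoCutoffLadder

end
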